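import Literature.Geometry.Lorentzian.NearIdentityPullback
import Literature.Geometry.Lorentzian.KerrSchildCoord
import Literature.Geometry.Lorentzian.MultiCentreKerrSchild
import HarnessLib

/-!
# The coordinate pullback of a boosted Kerr–Schild field along an affine Poincaré re-gauging

Topic `Geometry/Lorentzian` (namespace `Literature.Geometry.Lorentzian`). Let `Kₙ = g_{Λₙ,cₙ,Mₙ,aₙ}`
and `Kₗ = g_{Λₗ,cₗ,Mₗ,aₗ}` be two boosted, translated Kerr–Schild forms on `ℝ⁴`
(`boostedKerrBilin`, Kerr–Schild 1965: `g(x)(v, w) = g_{M,a}(Λ⁻¹(x − c))(Λ⁻¹v, Λ⁻¹w)`), and let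
`Θ : ℝ⁴ → ℝ⁴` be a coordinate change which, near a point `x`, is the AFFINE Poincaré re-gauging
with frame map `T`: `DΘ = Λₙ ∘ T` and `Λₙ⁻¹(Θ y − cₙ) = T (y − cₗ) + β ∂₀`. Then near `x` the
coordinate pullback (`bilinPullback`, O'Neill 1983, Ch. 3, Def. 3.9) of `Kₙ` along `Θ` is the
"MotionRebase form" `y ↦ g_{Mₙ,aₙ}(T(y − cₗ))(T ·, T ·)` — the time shift `β ∂₀` is absorbed by
the stationarity of the Kerr–Schild components (`Kerr.bilin_add_smul_basisVector_zero`,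
Kerr–Schild 1965, §2): `bilinPullback_boostedKerrBilin_of_frame`.

Consequently (`norm_iteratedFDeriv_reanchor_near_le`), if `Θ` is moreover `C^{k+1}`-close to the
identity at `x` and `F` is a `Cᵏ` field with `‖DʲF(Θ x)‖ ≤ N` (`j ≤ k`), then for `m ≤ k`
`‖Dᵐ(y ↦ bilinPullback Θ (F + Kₙ)(y) − Kₗ(y))(x)‖ ≤ 4ᵏ k! 2^{k+2} N + δ`, where `δ` bounds the `Cᵏ`
distance at `x` between the MotionRebase form and `Kₗ` — the near-zone half of "re-anchoring a
hand-over slab to a nearby multi-Kerr configuration costs `O(accuracy) + O(configuration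
distance)`". All `[folklore]`; no definitions.

## References
* [KerrSchild1965] R. P. Kerr, A. Schild, *A new class of vacuum solutions of the Einstein field
  equations*, Atti del Convegno sulla Relatività Generale, Firenze 1965, §2–§3.
* [ONeill1983] B. O'Neill, *Semi-Riemannian Geometry*, Academic Press 1983, Ch. 3, Def. 3.9;
  Ch. 9, p. 236 (Poincaré motions).
-/

noncomputable section

open Set Filter Topology Function
open scoped ContDiff Nat

namespace Literature.Geometry.Lorentzian

/-- **The re-anchoring identity.** If at `y` the coordinate change `Θ` has Jacobian `Λₙ ∘ T` and
rest-frame value `Λₙ⁻¹(Θ y − cₙ) = T(y − cₗ) + β ∂₀`, then the pullback of the boosted Kerr–Schild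
form `g_{Λₙ,cₙ,M,a}` along `Θ` at `y` is `g_{M,a}(T(y − cₗ))(T ·, T ·)` (stationarity absorbs the
time shift; Kerr–Schild 1965, §2). [cite: KerrSchild1965, §2] -/
theorem bilinPullback_boostedKerrBilin_of_frame {Θ : E4 → E4} {Λₙ : lorentzGroup} {cₙ cₗ : E4}
    {T : E4 →L[ℝ] E4} {β : ℝ} (M a : ℝ) {y : E4}
    (hd : fderiv ℝ Θ y = ((Λₙ : E4 ≃L[ℝ] E4) : E4 →L[ℝ] E4).comp T)
    (hp : poincareInv Λₙ cₙ (Θ y) = T (y - cₗ) + β • E4.basisVector 0) :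
    bilinPullback Θ (boostedKerrBilin Λₙ cₙ M a) y =
      (ContinuousLinearMap.precomp ℝ T).comp ((Kerr.bilin M a (T (y - cₗ))).comp T) := by
  ext u v
  rw [bilinPullback_apply, hd, boostedKerrBilin_apply, hp, Kerr.bilin_add_smul_basisVector_zero]
  simp

/-- The set where the rest-frame Kerr–Schild radius of the motion `(Λ, c)` is positive is open
(continuity of `Kerr.radius` and of the Poincaré map). [folklore] -/
theorem isOpen_setOf_radius_poincareInv_pos (Λ : lorentzGroup) (c : E4) (a : ℝ) :
    IsOpen {z : E4 | 0 < Kerr.radius a (poincareInv Λ c z)} :=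
  isOpen_lt continuous_const ((Kerr.continuous_radius a).comp (continuous_poincareInv Λ c))

/-- The boosted Kerr–Schild form is `Cⁿ` on the open set of positive rest-frame radius
(`contDiffAt_boostedKerrBilin`; Kerr–Schild 1965, §3). [cite: KerrSchild1965, §3] -/
theorem contDiffOn_boostedKerrBilin (Λ : lorentzGroup) (c : E4) (M a : ℝ) {n : WithTop ℕ∞} :
    ContDiffOn ℝ n (boostedKerrBilin Λ c M a) {z : E4 | 0 < Kerr.radius a (poincareInv Λ c z)} :=
  fun _ hz ↦ (contDiffAt_boostedKerrBilin Λ c M a hz).contDiffWithinAt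

/-- **Near-zone jets of a re-anchored hand-over slab.** Let `Θ` be `C^{k+1}` on an open `s ∋ x`,
`C^{k+1}`-close to the identity at `x` (`‖DΘ(x) − id‖ ≤ η`, `‖DᵐΘ(x)‖ ≤ η`, `2 ≤ m ≤ k + 1`,
`η ≤ 1`) and, near `x`, the affine re-gauging with frame `T` (`DΘ = Λₙ ∘ T`,
`Λₙ⁻¹(Θ y − cₙ) = T(y − cₗ) + β ∂₀`); let `F` be `Cᵏ` on an open `t ⊇ Θ(s)` with `‖DʲF(Θ x)‖ ≤ N`
(`j ≤ k`); let both rest-frame radii be positive at `x`; and let the MotionRebase form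
`y ↦ g_{Mₙ,aₙ}(T(y − cₗ))(T ·, T ·)` be `δ`-close in `Cᵏ` at `x` to `g_{Λₗ,cₗ,Mₗ,aₗ}`. Then
`‖Dᵐ(y ↦ bilinPullback Θ (F + g_{Λₙ,cₙ,Mₙ,aₙ})(y) − g_{Λₗ,cₗ,Mₗ,aₗ}(y))(x)‖ ≤ 4ᵏ k! 2^{k+2} N + δ`
for `m ≤ k` (linearity of the pullback, the re-anchoring identity, and the near-identity
estimate `norm_iteratedFDeriv_bilinPullback_le_of_near_id`). [folklore] -/
theorem norm_iteratedFDeriv_reanchor_near_le {Θ : E4 → E4} {F : E4 → E4 →L[ℝ] E4 →L[ℝ] ℝ}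
    (Λₙ Λₗ : lorentzGroup) (cₙ cₗ : E4) (Mₙ aₙ Mₗ aₗ : ℝ) (T : E4 →L[ℝ] E4) (β : ℝ)
    {s t : Set E4} (hs : IsOpen s) (ht : IsOpen t) {k : ℕ}
    (hΘ : ContDiffOn ℝ (k + 1) Θ s) (hF : ContDiffOn ℝ k F t) (hst : MapsTo Θ s t)
    {x : E4} (hx : x ∈ s) {η N δ : ℝ} (hη1 : η ≤ 1) (hN : 0 ≤ N)
    (h1 : ‖fderiv ℝ Θ x - ContinuousLinearMap.id ℝ E4‖ ≤ η)
    (h2 : ∀ m, 2 ≤ m → m ≤ k + 1 → ‖iteratedFDeriv ℝ m Θ x‖ ≤ η)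
    (hFb : ∀ j, j ≤ k → ‖iteratedFDeriv ℝ j F (Θ x)‖ ≤ N)
    (hloc : ∀ᶠ y in 𝓝 x, fderiv ℝ Θ y = ((Λₙ : E4 ≃L[ℝ] E4) : E4 →L[ℝ] E4).comp T ∧
      poincareInv Λₙ cₙ (Θ y) = T (y - cₗ) + β • E4.basisVector 0)
    (hposₙ : 0 < Kerr.radius aₙ (poincareInv Λₙ cₙ (Θ x)))
    (hposₗ : 0 < Kerr.radius aₗ (poincareInv Λₗ cₗ x))
    (hδ : ∀ i ≤ k, ‖iteratedFDeriv ℝ i (fun z ↦ (ContinuousLinearMap.precomp ℝ T).comp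
        ((Kerr.bilin Mₙ aₙ (T (z - cₗ))).comp T)) x -
      iteratedFDeriv ℝ i (boostedKerrBilin Λₗ cₗ Mₗ aₗ) x‖ ≤ δ) {m : ℕ} (hm : m ≤ k) :
    ‖iteratedFDeriv ℝ m (fun y ↦ bilinPullback Θ
        (fun z ↦ F z + boostedKerrBilin Λₙ cₙ Mₙ aₙ z) y - boostedKerrBilin Λₗ cₗ Mₗ aₗ y) x‖ ≤
      4 ^ k * k ! * 2 ^ (k + 2) * N + δ := by
  set Kₙ := boostedKerrBilin Λₙ cₙ Mₙ aₙ with hKₙ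
  set Kₗ := boostedKerrBilin Λₗ cₗ Mₗ aₗ with hKₗ
  set G : E4 → E4 →L[ℝ] E4 →L[ℝ] ℝ := fun z ↦ (ContinuousLinearMap.precomp ℝ T).comp
    ((Kerr.bilin Mₙ aₙ (T (z - cₗ))).comp T) with hG
  -- near `x` the transferred deviation is `bilinPullback Θ F + (G − Kₗ)`
  have hGeq : bilinPullback Θ Kₙ =ᶠ[𝓝 x] G := by
    filter_upwards [hloc] with y hy
    exact bilinPullback_boostedKerrBilin_of_frame Mₙ aₙ hy.1 hy.2
  have hsplit : (fun y ↦ bilinPullback Θ (fun z ↦ F z + Kₙ z) y - Kₗ y) =ᶠ[𝓝 x]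
      bilinPullback Θ F + (G - Kₗ) := by
    filter_upwards [hGeq] with y hy
    rw [bilinPullback_add_apply, Pi.add_apply, Pi.sub_apply, ← hy]
    abel
  rw [(hsplit.iteratedFDeriv ℝ m).eq_of_nhds]
  -- smoothness at `x` of the three players
  have hθk1 : ContDiffOn ℝ ((k : ℕ∞) + 1) Θ s := hΘ.of_le (by exact_mod_cast le_rfl)
  have hxs : s ∈ 𝓝 x := hs.mem_nhds hx
  have hA : ContDiffAt ℝ k (bilinPullback Θ F) x :=
    ((ContDiffOn.bilinPullback hθk1 hF hs hst).contDiffAt hxs).of_le le_rfl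
  have hGx : ContDiffAt ℝ k G x := by
    set t' : Set E4 := {z : E4 | 0 < Kerr.radius aₙ (poincareInv Λₙ cₙ z)} with ht'
    have ht'o : IsOpen t' := isOpen_setOf_radius_poincareInv_pos Λₙ cₙ aₙ
    have hs'o : IsOpen (s ∩ Θ ⁻¹' t') := hΘ.continuousOn.isOpen_inter_preimage hs ht'o
    have hB : ContDiffAt ℝ k (bilinPullback Θ Kₙ) x :=
      ((ContDiffOn.bilinPullback (hθk1.mono inter_subset_left)
        (contDiffOn_boostedKerrBilin Λₙ cₙ Mₙ aₙ) hs'o (fun z hz ↦ hz.2)).contDiffAt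
        (hs'o.mem_nhds ⟨hx, hposₙ⟩)).of_le le_rfl
    exact hB.congr_of_eventuallyEq hGeq.symm
  have hKx : ContDiffAt ℝ k Kₗ x := contDiffAt_boostedKerrBilin Λₗ cₗ Mₗ aₗ hposₗ
  have hmk : (m : WithTop ℕ∞) ≤ k := by exact_mod_cast hm
  have hGK : ContDiffAt ℝ k (G - Kₗ) x := hGx.sub hKx
  rw [iteratedFDeriv_add_apply (hA.of_le hmk) (hGK.of_le hmk),
    iteratedFDeriv_sub_apply (hGx.of_le hmk) (hKx.of_le hmk)]
  exact (norm_add_le _ _).trans (add_le_add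
    (norm_iteratedFDeriv_bilinPullback_le_of_near_id hs ht hΘ hF hst hx hη1 hN h1 h2 hFb hm)
    (hδ m hm))

end Literature.Geometry.Lorentzian

end
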